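import Summits.KontsevichZagierPeriods.KontsevichZagierPeriods.Theorems.HyperbolicBlochIsometryMove
import Summits.KontsevichZagierPeriods.KontsevichZagierPeriods.Theorems.HyperbolicBlochOffTetraSectorKernelRedAux
import Summits.KontsevichZagierPeriods.KontsevichZagierPeriods.Theorems.HyperbolicBlochOffTetraSectorKernelStubSpxSemialgebraic
import Summits.KontsevichZagierPeriods.KontsevichZagierPeriods.Theorems.HyperbolicBlochOffTetraSectorKernelStubSpxSplit
import Literature.NumberTheory.Transcendental.KZIdealTetrahedron
import Literature.NumberTheory.Transcendental.KZSemiCanonicalReductionProofs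

/-!
# `OffTetraSectorKernel` (stmt-KontsevichZagierPeriods-10557) — line `odd-hyperbolic-ladder` (skeleton v3b),
finite-vertex reduction: the split step

Lead c2. `red_split_step` (registered sub-goal): if rows `0` and `i ≠ 0` of `v` are lifts of two distinct algebraic
points of the upper half space, then the absorption property `P` (a representation with integrand `t⁻³` exists on
`Spx v`; twice every such class is a `ℤ`-combination of standard ideal tetrahedra modulo the KZ moves) passes to
`Spx v` from the two simplices `v[0 := u]`, `v[i := u]` (`u` = exit point of the geodesic from vertex `i` through
vertex `0`, `redAux_exit_timelike`), by the landed splitting `stub_spxSplit` (one rule-(1a) instance,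
`KZ.of_sub_sum_of_mem_relations`) and restriction (`stub_spxSemialgebraic`). `P` enters as a predicate pinned by an
equivalence. [Dupont–Sah 1982, §3]
-/

noncomputable section

open Set MeasureTheory
open Literature.NumberTheory.Transcendental

namespace Summit.KontsevichZagierPeriods.HyperbolicBloch.OffTetraSectorKernel

/-! ### The split step of the finite-vertex reduction -/

/-- SPLIT STEP. If rows `0` and `i ≠ 0` of `v` are lifts of two distinct algebraic points of the upper half space, the
geodesic from vertex `i` through vertex `0` exits at an algebraic ideal point `u` (`redAux_exit_timelike`), the simplex
`v[0 := u]` is the a.e.-disjoint union of `Spx v` and `v[i := u]` (landed `stub_spxSplit`), and the absorption property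
`P` (existence of a representation with integrand `t⁻³`; twice every class a tetrahedral combination) passes from the two
pieces — each with one finite vertex fewer — to `Spx v`. [cite: DupontSah1982, §3] -/
theorem red_split_step :
    ∀ (Ql : (Fin 3 → ℝ) → Fin 4 → ℝ) (hQl : ∀ p, Ql p = ![p 0 ^ 2 + p 1 ^ 2 + p 2 ^ 2, p 0, p 1, 1])
    (Spx : (Fin 4 → Fin 4 → ℝ) → Set (Fin 3 → ℝ))
    (hSpx : ∀ v, Spx v = {p | 0 < p 2 ∧ ∀ a, 0 < (Matrix.of v).det * ((Matrix.of v).updateRow a (Ql p)).det})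
    (ρ : ℂ → KZ.IntegralRep 3) (P : (Fin 4 → Fin 4 → ℝ) → Prop)
    (hP : ∀ v, P v ↔ ((∃ r : KZ.IntegralRep 3, r.domain = Spx v ∧ EqOn r.integrand (fun p => 1 / p 2 ^ 3) r.domain) ∧
      (∀ r : KZ.IntegralRep 3, r.domain = Spx v → EqOn r.integrand (fun p => 1 / p 2 ^ 3) r.domain →
        ∃ (k : ℕ) (z : Fin k → ℂ) (e : Fin k → ℤ), (∀ i, IsAlgebraic ℚ (z i)) ∧ (∀ i, 0 < (z i).im) ∧
          2 • KZ.of r - ∑ i, e i • KZ.of (ρ (z i)) ∈ KZ.relations)))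
    (v : Fin 4 → Fin 4 → ℝ) (hvalg : ∀ i k, IsAlgebraic ℚ (v i k)) (i : Fin 4) (hi : i ≠ 0)
    (q₀ q₁ : Fin 3 → ℝ) (hq₀ : ∀ k, IsAlgebraic ℚ (q₀ k)) (hq₀2 : 0 < q₀ 2) (hq₁ : ∀ k, IsAlgebraic ℚ (q₁ k))
    (hq₁2 : 0 < q₁ 2) (hne : q₀ ≠ q₁) (hv0 : v 0 = Ql q₀) (hvi : v i = Ql q₁) (hdet : (Matrix.of v).det ≠ 0)
    (IH : ∀ u : Fin 4 → ℝ, (∀ k, IsAlgebraic ℚ (u k)) → (u 1 ^ 2 + u 2 ^ 2 = u 0 * u 3 ∧ 0 ≤ u 3 ∧ 0 < u 0 + u 3) →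
      (Matrix.of (Function.update v 0 u)).det ≠ 0 → (Matrix.of (Function.update v i u)).det ≠ 0 →
      P (Function.update v 0 u) ∧ P (Function.update v i u)),
    P v := by
  intro Ql hQl Spx hSpx ρ P hP v hvalg i hi q₀ q₁ hq₀ hq₀2 hq₁ hq₁2 hne hv0 hvi hdet IH
  classical
  obtain ⟨α, u, hαpos, hcomb, hunull, hualg⟩ := redAux_exit_timelike Ql hQl q₀ q₁ hq₀2 hq₁2 hne hq₀ hq₁
  have hcomb' : v 0 = α • v i + (1 : ℝ) • u := by rw [hv0, hvi]; exact hcomb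
  set W : Fin 4 → Fin 4 → ℝ := Function.update v 0 u with hW
  set V' : Fin 4 → Fin 4 → ℝ := Function.update v i u with hV'
  obtain ⟨hsub₁, hsub₂, hdisj, hnull0⟩ := stub_spxSplit Ql hQl Spx hSpx v i u α 1 hi hαpos one_pos hcomb' hdet
  -- determinants of the pieces
  have hdetW : (Matrix.of W).det = (Matrix.of v).det := by
    have e : (Matrix.of v).det = α * ((Matrix.of v).updateRow 0 (Matrix.of v i)).det +
        1 * ((Matrix.of v).updateRow 0 u).det := by
      conv_lhs => rw [← Matrix.updateRow_eq_self (Matrix.of v) 0]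
      rw [show (Matrix.of v) 0 = α • Matrix.of v i + (1 : ℝ) • u from hcomb', Matrix.det_updateRow_add,
        Matrix.det_updateRow_smul, Matrix.det_updateRow_smul]
    have z : ((Matrix.of v).updateRow 0 (Matrix.of v i)).det = 0 := by
      refine Matrix.det_zero_of_row_eq (i := 0) (j := i) hi.symm ?_
      simp [Matrix.updateRow_self, Matrix.updateRow_ne hi]
    rw [z, mul_zero, zero_add, one_mul] at e
    rw [hW]; exact e.symm
  have hdetW0 : (Matrix.of W).det ≠ 0 := by rw [hdetW]; exact hdet
  have hdetV' : (Matrix.of V').det = -α * (Matrix.of v).det := by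
    have hu2 : u = (1 : ℝ) • Matrix.of v 0 + (-α) • Matrix.of v i := by
      rw [show Matrix.of v 0 = v 0 from rfl, hcomb']; ext k; simp
    rw [hV', show Matrix.of (Function.update v i u) = (Matrix.of v).updateRow i u from rfl, hu2,
      Matrix.det_updateRow_add, Matrix.det_updateRow_smul, Matrix.det_updateRow_smul]
    have z : ((Matrix.of v).updateRow i (Matrix.of v 0)).det = 0 := by
      refine Matrix.det_zero_of_row_eq (i := i) (j := 0) hi ?_
      simp [Matrix.updateRow_self, Matrix.updateRow_ne hi.symm]
    rw [z, Matrix.updateRow_eq_self]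
    ring
  have hdetV'0 : (Matrix.of V').det ≠ 0 := by
    rw [hdetV']; exact mul_ne_zero (neg_ne_zero.mpr hαpos.ne') hdet
  -- the two pieces
  obtain ⟨hPW, hPV'⟩ := IH u hualg hunull hdetW0 hdetV'0
  obtain ⟨⟨R, hRd, hRi⟩, hWcls⟩ := (hP W).mp hPW
  obtain ⟨-, hV'cls⟩ := (hP V').mp hPV'
  -- semialgebraicity of the cone pieces
  have hV'alg : ∀ l k, IsAlgebraic ℚ (V' l k) := by
    intro l k
    rcases eq_or_ne l i with rfl | hl
    · simpa [hV'] using hualg k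
    · rw [hV', Function.update_of_ne hl]; exact hvalg l k
  have hsa : Literature.ModelTheory.ExponentialFields.IsSemialgebraic ℚ (Spx V') :=
    stub_spxSemialgebraic Ql hQl Spx hSpx V' hV'alg
  have hsav : Literature.ModelTheory.ExponentialFields.IsSemialgebraic ℚ (Spx v) :=
    stub_spxSemialgebraic Ql hQl Spx hSpx v hvalg
  have hsubR : Spx V' ⊆ R.domain := by rw [hRd]; exact hsub₂
  have hsubRv : Spx v ⊆ R.domain := by rw [hRd]; exact hsub₁
  set r' : KZ.IntegralRep 3 := R.restrict (Spx V') hsa hsubR with hr'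
  refine (hP v).mpr ⟨⟨R.restrict (Spx v) hsav hsubRv, rfl, fun p hp => hRi (hsubRv hp)⟩, ?_⟩
  intro r hr hri
  -- dissection
  have hrel : KZ.of R - KZ.of r - KZ.of r' ∈ KZ.relations := by
    have key := KZ.of_sub_sum_of_mem_relations (Finset.univ : Finset (Fin 2)) R ![r, r'] ?_ ?_ ?_ ?_
    · simpa [Fin.sum_univ_two, sub_sub] using key
    · intro l _
      fin_cases l
      · show volume (r.domain \ R.domain) = 0
        rw [hr, hRd, Set.sdiff_eq_empty.mpr hsub₁, measure_empty]
      · show volume (r'.domain \ R.domain) = 0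
        rw [show r'.domain = Spx V' from rfl, hRd, Set.sdiff_eq_empty.mpr hsub₂, measure_empty]
    · intro l _
      fin_cases l
      · show EqOn r.integrand R.integrand (r.domain ∩ R.domain)
        intro p hp
        rw [hri hp.1, hRi hp.2]
      · show EqOn r'.integrand R.integrand (r'.domain ∩ R.domain)
        intro p _
        rfl
    · have hU : (⋃ l ∈ (Finset.univ : Finset (Fin 2)), (![r, r'] l).domain) = r.domain ∪ r'.domain := by
        ext p
        simp only [Finset.mem_univ, iUnion_true, mem_iUnion, mem_union]
        constructor
        · rintro ⟨l, hl⟩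
          fin_cases l
          · exact Or.inl hl
          · exact Or.inr hl
        · rintro (h | h)
          · exact ⟨0, h⟩
          · exact ⟨1, h⟩
      rw [hU, hRd, hr]
      exact hnull0
    · intro l _ l' _ hll
      fin_cases l <;> fin_cases l'
      · exact absurd rfl hll
      · show volume (r.domain ∩ r'.domain) = 0
        rw [hr, show r'.domain = Spx V' from rfl, hdisj.inter_eq, measure_empty]
      · show volume (r'.domain ∩ r.domain) = 0
        rw [hr, show r'.domain = Spx V' from rfl, inter_comm, hdisj.inter_eq, measure_empty]
      · exact absurd rfl hll
  obtain ⟨k₁, z₁, e₁, hz₁, hz₁i, h₁⟩ := hWcls R hRd hRi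
  obtain ⟨k₂, z₂, e₂, hz₂, hz₂i, h₂⟩ := hV'cls r' rfl (fun p hp => hRi (hsubR hp))
  refine ⟨k₁ + k₂, Fin.append z₁ z₂, Fin.append e₁ (-e₂), ?_, ?_, ?_⟩
  · intro l
    refine Fin.addCases (fun j => ?_) (fun j => ?_) l
    · simpa only [Fin.append_left] using hz₁ j
    · simpa only [Fin.append_right] using hz₂ j
  · intro l
    refine Fin.addCases (fun j => ?_) (fun j => ?_) l
    · simpa only [Fin.append_left] using hz₁i j
    · simpa only [Fin.append_right] using hz₂i j
  · rw [Fin.sum_univ_add]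
    simp only [Fin.append_left, Fin.append_right, Pi.neg_apply, neg_smul, Finset.sum_neg_distrib]
    have key : 2 • KZ.of r - (∑ x : Fin k₁, e₁ x • KZ.of (ρ (z₁ x)) + -∑ x : Fin k₂, e₂ x • KZ.of (ρ (z₂ x))) =
        -(2 • (KZ.of R - KZ.of r - KZ.of r')) + (2 • KZ.of R - ∑ x : Fin k₁, e₁ x • KZ.of (ρ (z₁ x)))
          - (2 • KZ.of r' - ∑ x : Fin k₂, e₂ x • KZ.of (ρ (z₂ x))) := by
      simp only [smul_sub]; abel
    rw [key]
    exact sub_mem (add_mem (neg_mem (nsmul_mem hrel 2)) h₁) h₂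



end Summit.KontsevichZagierPeriods.HyperbolicBloch.OffTetraSectorKernel

end
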